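import Literature.NumberTheory.Transcendental.QuadraticRelationsLogarithmsSec5SubspaceForm
import HarnessLib

/-!
# Roy–Waldschmidt 1997, §5: the integrality endgame of the proof of Théorème 5.1 (p. 784)

D. Roy, M. Waldschmidt, Ann. Sci. ÉNS (4) 30 (1997) 753–796, end of the proof of Théorème 5.1,
p. 784.  After the analytic part of the proof (Théorèmes 2.1, 3.1, 4.1 and the choice of parameters,
pp. 780–783) one has, for the obstructing subgroup `L`, the inequality

(5.3) `((d - 2n) + ε₁(n - d₀) + ε₂(d₀ - n) - ε₃(d + 2d₁))(d₁' + λ')`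
      `≤ d₁((d' - ℓ₀') + ε₁(ℓ₀' - d₀') + ε₂(d₀' - ℓ₀' - λ_a') + ε₃(1 + ℓ₀'))`,

`ε₁ = log log D / log D`, `ε₂ = log κ / log D`, `ε₃ = log log κ / log D`.  "Or, les coefficients des
`εᵢ` dans les deux membres de (5.3) sont des entiers de valeur absolue `≤ 3d(d + λ)`.  Donc, si on
choisit `κ` suffisamment grand pour que les nombres `ε₁`, `ε₂/ε₁` et `ε₃/ε₂` soient tous
`< (6d(d + λ) + 1)⁻¹`, alors (5.3) implique (5.4) `(d - 2n)(d₁' + λ') ≤ d₁(d' - ℓ₀')` et, en cas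
d'égalité dans (5.4), (5.5) `(n - d₀)(d₁' + λ') ≤ d₁(ℓ₀' - d₀')` et, en cas d'égalité dans (5.4) et
(5.5), `(d₀ - n)(d₁' + λ') ≤ d₁(d₀' - ℓ₀' - λ_a')` c'est-à-dire `λ_a' = 0`, par comparaison avec
(5.5).  Comme `λ_a'` et chacun des nombres apparaissant dans les deux membres de (5.4) et (5.5) sont
des entiers de valeur absolue `≤ d(d + λ)`, ce résultat est équivalent à l'inégalité (5.1) du
théorème quelque soit `ε` avec `0 < ε ≤ (2d(d + λ) + 1)⁻¹`.  Le théorème est démontré."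

Writing `α = d₁(d' - ℓ₀') - (d - 2n)(d₁' + λ')`, `β = d₁(ℓ₀' - d₀') - (n - d₀)(d₁' + λ')`,
`γ = d₁λ_a'`, inequality (5.1) reads `0 ≤ α + βε - γε²` and (5.3) reads
`0 ≤ α + ε₁β - ε₂(β + γ) + ε₃δ` for an integer `δ`.  This file PROVES:

* `endgame_trichotomy` — integers `α, β, γ ≥ 0, δ` bounded by `B`, reals
  `0 < ε₃ ≪ ε₂ ≪ ε₁ ≪ 1` (ratios `≤ (4B)⁻¹`) and `0 ≤ α + ε₁β - ε₂(β+γ) + ε₃δ` force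
  `α ≥ 0`, `α = 0 → β ≥ 0`, `α = β = 0 → γ = 0` (this is (5.4), (5.5), `λ_a' = 0`);
* `quadratic_nonneg_of_trichotomy` — conversely these give `0 ≤ α + βε - γε²` for
  `0 < ε ≤ (2M+1)⁻¹` when `|β| ≤ 2M`, `γ ≤ M`;
* `h51sub_clause_of_ineq53` — **the endgame for an object `X = (d₀, d₁, W, Y, Y_a)` in the generic
  case `d > 2n`, `n ≥ d₀`, `d₁ > 0` and a pair `(T₀, T₁)` (i.e. `L = L₀ × L₁`)**: an inequality of the
  shape (5.3) with small enough `εᵢ` implies the conclusion (5.1) of Théorème 5.1 in the subspace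
  form of `…Sec5SubspaceForm.lean`, for every `0 < ε ≤ (2d(d+λ)+1)⁻¹`.

No definitions, no named facts.

## References

* [RoyWaldschmidt1997ENS] D. Roy, M. Waldschmidt, Ann. Sci. ÉNS (4) 30 (1997) 753–796, proof of
  Théorème 5.1, p. 784 (read on the rendered scan).
-/

noncomputable section

open Complex IntermediateField Module Submodule

namespace Literature.NumberTheory.Transcendental

namespace RoyWaldschmidt1997

open LiePresentation

/-! ### The abstract endgame -/

/-- **(5.3) ⟹ (5.4), (5.5), `λ_a' = 0`** (Roy–Waldschmidt 1997, p. 784): if `α, β, γ, δ` are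
integers with `|β|, γ ≤ B`, `γ ≥ 0`, `δ ≤ B` real, if `0 < ε₃`, `4Bε₃ ≤ ε₂`, `4Bε₂ ≤ ε₁`, `4Bε₁ ≤ 1` and
`0 ≤ α + ε₁β - ε₂(β + γ) + ε₃δ`, then `α ≥ 0`; `β ≥ 0` if `α = 0`; and `γ = 0` if `α = β = 0`
(integrality: a negative integer is `≤ -1` and the later terms are too small to compensate).
[cite: RoyWaldschmidt1997ENS, proof of Théorème 5.1, p. 784] -/
theorem endgame_trichotomy {α β γ : ℤ} {δ : ℝ} {B : ℕ} (hβ : |β| ≤ B) (hγ0 : 0 ≤ γ) (hγ : γ ≤ B)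
    (hδ : δ ≤ B) {ε₁ ε₂ ε₃ : ℝ} (h3 : 0 < ε₃) (h32 : 4 * B * ε₃ ≤ ε₂) (h21 : 4 * B * ε₂ ≤ ε₁)
    (h1 : 4 * B * ε₁ ≤ 1) (h53 : 0 ≤ (α : ℝ) + ε₁ * β - ε₂ * (β + γ) + ε₃ * δ) :
    0 ≤ α ∧ (α = 0 → 0 ≤ β) ∧ (α = 0 → β = 0 → γ = 0) := by
  have hβR : |(β : ℝ)| ≤ B := by exact_mod_cast hβ
  have hγR : (γ : ℝ) ≤ B := by exact_mod_cast hγ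
  have hγ0R : (0 : ℝ) ≤ γ := by exact_mod_cast hγ0
  have hB0 : (0 : ℝ) ≤ B := Nat.cast_nonneg _
  obtain ⟨hβ1, hβ2⟩ := abs_le.mp hβR
  -- the case `B = 0` is trivial
  rcases Nat.eq_zero_or_pos B with hB | hB
  · subst hB
    have hb : β = 0 := by exact_mod_cast (abs_nonpos_iff.mp (by simpa using hβ))
    have hc : γ = 0 := le_antisymm (by exact_mod_cast hγ) hγ0
    have hd' : δ ≤ 0 := by simpa using hδ
    subst hb; subst hc
    refine ⟨?_, fun _ => le_rfl, fun _ _ => rfl⟩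
    have h' : (0 : ℝ) ≤ α + ε₃ * δ := by simpa using h53
    have : ε₃ * δ ≤ 0 := mul_nonpos_of_nonneg_of_nonpos h3.le hd'
    have : (0 : ℝ) ≤ α := by linarith
    exact_mod_cast this
  have hB1 : (1 : ℝ) ≤ B := by exact_mod_cast hB
  have h2pos : 0 < ε₂ := lt_of_lt_of_le (by positivity) h32
  have h1pos : 0 < ε₁ := lt_of_lt_of_le (by positivity) h21
  -- the sizes of the three small terms
  have hε₃B : ε₃ * B ≤ ε₂ / 4 := by nlinarith
  have hε₂B : ε₂ * B ≤ ε₁ / 4 := by nlinarith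
  have hε₁B : ε₁ * B ≤ 1 / 4 := by nlinarith
  have ht1 : ε₁ * β ≤ ε₁ * B := mul_le_mul_of_nonneg_left hβ2 h1pos.le
  have ht2 : -(ε₂ * (β + γ)) ≤ ε₂ * B := by nlinarith
  have ht3 : ε₃ * δ ≤ ε₃ * B := mul_le_mul_of_nonneg_left hδ h3.le
  refine ⟨?_, fun hα => ?_, fun hα hβ0 => ?_⟩
  · by_contra hneg
    have hα1' : α ≤ -1 := by have := not_le.mp hneg; omega
    have hα1 : (α : ℝ) ≤ -1 := by exact_mod_cast hα1'
    nlinarith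
  · subst hα
    by_contra hneg
    have hb1' : β ≤ -1 := by have := not_le.mp hneg; omega
    have hb1 : (β : ℝ) ≤ -1 := by exact_mod_cast hb1'
    -- `ε₁β - ε₂β = β(ε₁ - ε₂) ≤ -(ε₁ - ε₂)`, `-ε₂γ ≤ 0`, `ε₃δ ≤ ε₂/4`
    have h12 : ε₂ ≤ ε₁ / 4 := by nlinarith
    have hA : ε₁ * β - ε₂ * β ≤ -(ε₁ - ε₂) := by nlinarith
    have hC : -(ε₂ * (γ : ℝ)) ≤ 0 := by nlinarith
    have : (0 : ℝ) ≤ 0 + ε₁ * β - ε₂ * (β + γ) + ε₃ * δ := by simpa using h53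
    nlinarith
  · subst hα; subst hβ0
    by_contra hneg
    have hc1 : (1 : ℝ) ≤ γ := by
      have : 0 < γ := lt_of_le_of_ne hγ0 (Ne.symm hneg)
      exact_mod_cast this
    have : (0 : ℝ) ≤ 0 + ε₁ * 0 - ε₂ * (0 + γ) + ε₃ * δ := by simpa using h53
    nlinarith

/-- **(5.4), (5.5), `λ_a' = 0` ⟹ (5.1)** (Roy–Waldschmidt 1997, p. 784): if `α ≥ 0`,
`α = 0 → β ≥ 0`, `α = β = 0 → γ = 0` for integers with `|β| ≤ 2M`, `0 ≤ γ ≤ M`, then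
`0 ≤ α + βε - γε²` for every real `0 < ε ≤ (2M + 1)⁻¹`.
[cite: RoyWaldschmidt1997ENS, proof of Théorème 5.1, p. 784] -/
theorem quadratic_nonneg_of_trichotomy {α β γ : ℤ} {M : ℕ} (hβ : |β| ≤ 2 * M) (hγ0 : 0 ≤ γ)
    (hγ : γ ≤ M) (hα : 0 ≤ α) (hαβ : α = 0 → 0 ≤ β) (hαβγ : α = 0 → β = 0 → γ = 0)
    {ε : ℝ} (hε : 0 < ε) (hε' : ε ≤ 1 / (2 * M + 1)) :
    0 ≤ (α : ℝ) + β * ε - γ * ε ^ 2 := by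
  have hβR : |(β : ℝ)| ≤ 2 * M := by exact_mod_cast hβ
  obtain ⟨hβ1, hβ2⟩ := abs_le.mp hβR
  have hγR : (γ : ℝ) ≤ M := by exact_mod_cast hγ
  have hγ0R : (0 : ℝ) ≤ γ := by exact_mod_cast hγ0
  have hM0 : (0 : ℝ) ≤ M := Nat.cast_nonneg _
  have hden : (0 : ℝ) < 2 * M + 1 := by positivity
  have hεM : ε * (2 * M + 1) ≤ 1 := by
    have := (le_div_iff₀ hden).mp hε'
    linarith
  have hε1 : ε ≤ 1 := by nlinarith
  rcases lt_or_eq_of_le hα with hpos | hzero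
  · -- `α ≥ 1`: `α + βε - γε² ≥ 1 - 2Mε - Mε² > 0`
    have hα1 : (1 : ℝ) ≤ α := by exact_mod_cast hpos
    have hb : -(2 * M * ε) ≤ β * ε := by nlinarith
    have hc : γ * ε ^ 2 ≤ M * ε ^ 2 := by nlinarith
    -- `1 - 2Mε - Mε² ≥ 1 - 2Mε - Mε = 1 - ε(2M+1) + ... `; use `Mε² ≤ Mε · 1`, and `2Mε + Mε ≤ ?`
    -- precise: `2Mε ≤ 2M/(2M+1)` and `Mε² ≤ M/(2M+1)²`; we argue via `ε(2M+1) ≤ 1`.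
    have h1 : 2 * M * ε + M * ε ^ 2 < 1 := by
      have hMε : M * ε ≤ (1 - ε) / 2 := by nlinarith
      have : M * ε ^ 2 ≤ (1 - ε) / 2 * ε := by nlinarith
      nlinarith
    nlinarith
  · subst hzero
    have hβ0 := hαβ rfl
    rcases lt_or_eq_of_le hβ0 with hbpos | hbzero
    · have hb1 : (1 : ℝ) ≤ β := by exact_mod_cast hbpos
      -- `ε(β - γε) ≥ ε(1 - Mε) > 0`
      have hMε : (M : ℝ) * ε < 1 := by nlinarith
      have : 0 ≤ ε * (β - γ * ε) := by
        refine mul_nonneg hε.le ?_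
        nlinarith
      have e : ((0 : ℤ) : ℝ) + β * ε - γ * ε ^ 2 = ε * (β - γ * ε) := by push_cast; ring
      rw [e]; exact this
    · subst hbzero
      have hc := hαβγ rfl rfl
      subst hc
      simp

/-! ### Bounds on the intrinsic quantities of a pair `(T₀, T₁)` -/

variable {K : IntermediateField ℚ ℂ}

/-- `rang(Y_a) - rang(Y_a ∩ S) ≤ rang(Y) - rang(Y ∩ S)` for any subgroup `S` (the quotient
`Y_a/(Y_a ∩ S)` embeds in `Y/(Y ∩ S)`). [folklore] -/
theorem RWObj.ellA_sub_le_ell₁_sub (X : RWObj K) (S : Submodule ℤ ((Fin X.d₀ → ℂ) × (Fin X.d₁ → ℂ))) :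
    X.ellA - Module.finrank ℤ ↥(X.Ya ⊓ S) ≤ X.ell₁ - Module.finrank ℤ ↥(X.Y ⊓ S) := by
  classical
  let ψ : ((Fin X.d₀ → ℂ) × (Fin X.d₁ → ℂ)) →ₗ[ℤ] ((Fin X.d₀ → ℂ) × (Fin X.d₁ → ℂ)) ⧸ S :=
    S.mkQ
  have hker : LinearMap.ker ψ = S := Submodule.ker_mkQ S
  have hY := finrank_map_add_finrank_inf_ker_int X.Y X.hYfg ψ
  have hYa := finrank_map_add_finrank_inf_ker_int X.Ya X.fg_Ya ψ
  rw [hker] at hY hYa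
  have hle : Module.finrank ℤ ↥(X.Ya.map ψ) ≤ Module.finrank ℤ ↥(X.Y.map ψ) :=
    finrank_le_of_le_fg (Submodule.map_mono X.hYa) (X.hYfg.map _)
  simp only [RWObj.ellA, RWObj.ell₁]
  omega

/-- `rang(Y ∩ S) ≤ rang(Y) = ℓ₁`. [folklore] -/
theorem RWObj.finrank_inf_le_ell₁ (X : RWObj K) (S : Submodule ℤ ((Fin X.d₀ → ℂ) × (Fin X.d₁ → ℂ))) :
    Module.finrank ℤ ↥(X.Y ⊓ S) ≤ X.ell₁ :=
  finrank_le_of_le_fg inf_le_left X.hYfg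

/-- `rang(Y_a ∩ S) ≤ rang(Y_a) = ℓ_a`. [folklore] -/
theorem RWObj.finrank_inf_le_ellA (X : RWObj K) (S : Submodule ℤ ((Fin X.d₀ → ℂ) × (Fin X.d₁ → ℂ))) :
    Module.finrank ℤ ↥(X.Ya ⊓ S) ≤ X.ellA :=
  finrank_le_of_le_fg inf_le_left X.fg_Ya

/-- `κ = rang(Y ∩ Ω) ≤ rang(Y ∩ S)` when `Ω ≤ S`. [folklore] -/
theorem RWObj.kap_le_finrank_inf (X : RWObj K) (S : Submodule ℤ ((Fin X.d₀ → ℂ) × (Fin X.d₁ → ℂ)))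
    (hS : omegaLattice X.d₀ X.d₁ ≤ S) : X.kap ≤ Module.finrank ℤ ↥(X.Y ⊓ S) := by
  haveI : Module.Finite ℤ X.Y := X.finite_Y
  have hfg : (X.Y ⊓ S).FG := Module.Finite.iff_fg.mp
    (Module.Finite.of_injective (Submodule.inclusion (inf_le_left : X.Y ⊓ S ≤ X.Y)) (Submodule.inclusion_injective _))
  exact finrank_le_of_le_fg (inf_le_inf_left X.Y hS) hfg

/-- `dim_K(W ∩ T) ≤ dim_K W = ℓ₀`. [folklore] -/
theorem RWObj.finrank_inf_le_ell₀ (X : RWObj K) (T : Submodule K ((Fin X.d₀ → ℂ) × (Fin X.d₁ → ℂ))) :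
    Module.finrank K ↥(X.W ⊓ T) ≤ X.ell₀ := by
  haveI : Module.Finite K X.W := X.finite_W
  exact LinearMap.finrank_le_finrank_of_injective
    (f := Submodule.inclusion (inf_le_left : X.W ⊓ T ≤ X.W)) (Submodule.inclusion_injective _)

/-! ### The endgame for an object and a pair `(T₀, T₁)` -/

set_option maxHeartbeats 1600000 in
/-- **The endgame of the proof of Théorème 5.1** (Roy–Waldschmidt 1997, p. 784), for an object
`X = (d₀, d₁, W, Y, Y_a)` with `d > 2n`, `n ≥ d₀`, `d₁ > 0` and a pair `T₀ ⊆ ℂ^{d₀}`, `T₁ ⊆ ℂ^{d₁}`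
(the tangent spaces of `L = L₀ × L₁`), in the subspace form of `…Sec5SubspaceForm.lean`
(`d₀' = d₀ - dim T₀`, `d₁' = d₁ - dim T₁`, `ℓ₀' = ℓ₀ - dim_K(W ∩ (T₀ × T₁))`,
`λ' = ℓ₁ - rang(Y ∩ ((T₀ × T₁) + Ω))`, `λ_a' = ℓ_a - rang(Y_a ∩ ((T₀ × T₁) + Ω))`, `λ = ℓ₁ - κ`):
if for some real `δ ≤ B`, `B ≥ 2d(d + λ)`, and reals `0 < ε₃`, `4Bε₃ ≤ ε₂`,
`4Bε₂ ≤ ε₁`, `4Bε₁ ≤ 1` one has the inequality of shape (5.3)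
`0 ≤ α + ε₁β - ε₂(β + γ) + ε₃δ`, `α = d₁(d' - ℓ₀') - (d - 2n)(d₁' + λ')`,
`β = d₁(ℓ₀' - d₀') - (n - d₀)(d₁' + λ')`, `γ = d₁λ_a'`, then (5.1) holds for every
`0 < ε ≤ (2d(d + λ) + 1)⁻¹`. [cite: RoyWaldschmidt1997ENS, proof of Théorème 5.1, p. 784] -/
theorem h51sub_clause_of_ineq53 (X : RWObj K) (hgen : 2 * X.nn < X.d₀ + X.d₁) (hd₀n : X.d₀ ≤ X.nn)
    (T₀ : Submodule ℂ (Fin X.d₀ → ℂ)) (T₁ : Submodule ℂ (Fin X.d₁ → ℂ))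
    {B : ℕ} (hB : 2 * (X.d₀ + X.d₁) * ((X.d₀ + X.d₁) + (X.ell₁ - X.kap)) ≤ B)
    {δ : ℝ} (hδ : δ ≤ B) {ε₁ ε₂ ε₃ : ℝ} (h3 : 0 < ε₃) (h32 : 4 * B * ε₃ ≤ ε₂)
    (h21 : 4 * B * ε₂ ≤ ε₁) (h1 : 4 * B * ε₁ ≤ 1)
    (h53 : 0 ≤
      ((X.d₁ : ℝ) * ((((X.d₀ : ℝ) - Module.finrank ℂ T₀) + ((X.d₁ : ℝ) - Module.finrank ℂ T₁)) -
            ((X.ell₀ : ℝ) - Module.finrank K ↥(X.W ⊓ (T₀.prod T₁).restrictScalars K))) -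
        (((X.d₀ : ℝ) + X.d₁) - 2 * X.nn) *
          (((X.d₁ : ℝ) - Module.finrank ℂ T₁) + ((X.ell₁ : ℝ) -
            Module.finrank ℤ ↥(X.Y ⊓ ((T₀.prod T₁).restrictScalars ℤ ⊔ omegaLattice X.d₀ X.d₁)))))
      + ε₁ * ((X.d₁ : ℝ) * (((X.ell₀ : ℝ) - Module.finrank K ↥(X.W ⊓ (T₀.prod T₁).restrictScalars K)) -
            ((X.d₀ : ℝ) - Module.finrank ℂ T₀)) -
        ((X.nn : ℝ) - X.d₀) *
          (((X.d₁ : ℝ) - Module.finrank ℂ T₁) + ((X.ell₁ : ℝ) -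
            Module.finrank ℤ ↥(X.Y ⊓ ((T₀.prod T₁).restrictScalars ℤ ⊔ omegaLattice X.d₀ X.d₁)))))
      - ε₂ * (((X.d₁ : ℝ) * (((X.ell₀ : ℝ) - Module.finrank K ↥(X.W ⊓ (T₀.prod T₁).restrictScalars K)) -
            ((X.d₀ : ℝ) - Module.finrank ℂ T₀)) -
        ((X.nn : ℝ) - X.d₀) *
          (((X.d₁ : ℝ) - Module.finrank ℂ T₁) + ((X.ell₁ : ℝ) -
            Module.finrank ℤ ↥(X.Y ⊓ ((T₀.prod T₁).restrictScalars ℤ ⊔ omegaLattice X.d₀ X.d₁))))) +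
        (X.d₁ : ℝ) * ((X.ellA : ℝ) -
            Module.finrank ℤ ↥(X.Ya ⊓ ((T₀.prod T₁).restrictScalars ℤ ⊔ omegaLattice X.d₀ X.d₁))))
      + ε₃ * δ) :
    ∀ ε : ℝ, 0 < ε → ε ≤ 1 / (2 * ((X.d₀ : ℝ) + X.d₁) * (((X.d₀ : ℝ) + X.d₁) + ((X.ell₁ : ℝ) - X.kap)) + 1) →
        ((((X.d₀ : ℝ) + X.d₁) - 2 * X.nn) + ε * ((X.nn : ℝ) - X.d₀)) *
            (((X.d₁ : ℝ) - Module.finrank ℂ T₁) + ((X.ell₁ : ℝ) -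
              Module.finrank ℤ ↥(X.Y ⊓ ((T₀.prod T₁).restrictScalars ℤ ⊔ omegaLattice X.d₀ X.d₁)))) ≤
          (X.d₁ : ℝ) * (((((X.d₀ : ℝ) - Module.finrank ℂ T₀) + ((X.d₁ : ℝ) - Module.finrank ℂ T₁)) -
              ((X.ell₀ : ℝ) - Module.finrank K ↥(X.W ⊓ (T₀.prod T₁).restrictScalars K))) +
            ε * (((X.ell₀ : ℝ) - Module.finrank K ↥(X.W ⊓ (T₀.prod T₁).restrictScalars K)) -
              ((X.d₀ : ℝ) - Module.finrank ℂ T₀)) -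
            ε ^ 2 * ((X.ellA : ℝ) -
              Module.finrank ℤ ↥(X.Ya ⊓ ((T₀.prod T₁).restrictScalars ℤ ⊔ omegaLattice X.d₀ X.d₁)))) := by
  classical
  intro ε hε0 hε
  -- names for the natural numbers involved
  set r₀ : ℕ := Module.finrank ℂ T₀ with hr₀
  set r₁ : ℕ := Module.finrank ℂ T₁ with hr₁
  set w : ℕ := Module.finrank K ↥(X.W ⊓ (T₀.prod T₁).restrictScalars K) with hw
  set S : Submodule ℤ ((Fin X.d₀ → ℂ) × (Fin X.d₁ → ℂ)) :=
    (T₀.prod T₁).restrictScalars ℤ ⊔ omegaLattice X.d₀ X.d₁ with hS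
  set y : ℕ := Module.finrank ℤ ↥(X.Y ⊓ S) with hy
  set ya : ℕ := Module.finrank ℤ ↥(X.Ya ⊓ S) with hya
  -- bounds
  have hr₀le : r₀ ≤ X.d₀ := by
    have := Submodule.finrank_le T₀
    simpa using this
  have hr₁le : r₁ ≤ X.d₁ := by
    have := Submodule.finrank_le T₁
    simpa using this
  have hwle : w ≤ X.ell₀ := X.finrank_inf_le_ell₀ _
  have hℓ₀n : X.ell₀ ≤ X.nn := X.ell₀_le_nn
  have hyle : y ≤ X.ell₁ := X.finrank_inf_le_ell₁ S
  have hkapy : X.kap ≤ y := X.kap_le_finrank_inf S (by rw [hS]; exact le_sup_right)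
  have hyale : ya ≤ X.ellA := X.finrank_inf_le_ellA S
  have hlamA : X.ellA - ya ≤ X.ell₁ - y := X.ellA_sub_le_ell₁_sub S
  have hkap : X.kap ≤ X.ell₁ := X.kap_le_ell₁
  have hnd : X.nn ≤ X.d₀ + X.d₁ := by omega
  -- the integers `α, β, γ` and `M = d(d+λ)`
  set lam : ℕ := X.ell₁ - X.kap with hlam
  set M : ℕ := (X.d₀ + X.d₁) * ((X.d₀ + X.d₁) + lam) with hM
  set d₀' : ℤ := (X.d₀ : ℤ) - r₀ with hd₀'
  set d₁' : ℤ := (X.d₁ : ℤ) - r₁ with hd₁'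
  set ℓ₀' : ℤ := (X.ell₀ : ℤ) - w with hℓ₀'
  set lam' : ℤ := (X.ell₁ : ℤ) - y with hlam'
  set lamA' : ℤ := (X.ellA : ℤ) - ya with hlamA'
  set α : ℤ := (X.d₁ : ℤ) * ((d₀' + d₁') - ℓ₀') - ((X.d₀ : ℤ) + X.d₁ - 2 * X.nn) * (d₁' + lam') with hα
  set β : ℤ := (X.d₁ : ℤ) * (ℓ₀' - d₀') - ((X.nn : ℤ) - X.d₀) * (d₁' + lam') with hβ
  set γ : ℤ := (X.d₁ : ℤ) * lamA' with hγ
  -- integer bounds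
  have h0d₀' : 0 ≤ d₀' ∧ d₀' ≤ X.d₀ := by constructor <;> [skip; skip] <;> omega
  have h0d₁' : 0 ≤ d₁' ∧ d₁' ≤ X.d₁ := by constructor <;> omega
  have h0ℓ₀' : 0 ≤ ℓ₀' ∧ ℓ₀' ≤ X.nn := by constructor <;> omega
  have h0lam' : 0 ≤ lam' ∧ lam' ≤ lam := by constructor <;> omega
  have h0lamA' : 0 ≤ lamA' ∧ lamA' ≤ lam := by constructor <;> omega
  have hMZ : (M : ℤ) = ((X.d₀ : ℤ) + X.d₁) * (((X.d₀ : ℤ) + X.d₁) + lam) := by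
    rw [hM]; push_cast; ring
  have hβB : |β| ≤ 2 * (M : ℤ) := by
    rw [abs_le]
    have hA : |(X.d₁ : ℤ) * (ℓ₀' - d₀')| ≤ M := by
      rw [abs_le, hMZ]
      constructor <;> nlinarith [h0d₀'.1, h0d₀'.2, h0ℓ₀'.1, h0ℓ₀'.2, h0lam'.1]
    have hBd : 0 ≤ ((X.nn : ℤ) - X.d₀) * (d₁' + lam') ∧ ((X.nn : ℤ) - X.d₀) * (d₁' + lam') ≤ M := by
      rw [hMZ]
      have h1 : (0 : ℤ) ≤ (X.nn : ℤ) - X.d₀ := by omega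
      have h2 : (X.nn : ℤ) - X.d₀ ≤ (X.d₀ : ℤ) + X.d₁ := by omega
      have h3 : 0 ≤ d₁' + lam' := by omega
      have h4 : d₁' + lam' ≤ ((X.d₀ : ℤ) + X.d₁) + lam := by omega
      constructor <;> nlinarith
    obtain ⟨hA1, hA2⟩ := abs_le.mp hA
    constructor <;> linarith [hBd.1, hBd.2]
  have hγ0 : 0 ≤ γ := by rw [hγ]; exact mul_nonneg (by positivity) h0lamA'.1
  have hγM : γ ≤ M := by
    rw [hγ, hMZ]
    have h1 : lamA' ≤ lam := h0lamA'.2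
    have h2 : (X.d₁ : ℤ) ≤ (X.d₀ : ℤ) + X.d₁ := by omega
    nlinarith [h0lamA'.1]
  have h2MB : 2 * (M : ℤ) ≤ B := by
    have : 2 * M ≤ B := by
      rw [hM, hlam]
      simpa [mul_assoc] using hB
    exact_mod_cast this
  have hβB' : |β| ≤ (B : ℤ) := le_trans hβB h2MB
  have hγB : γ ≤ (B : ℤ) := by linarith
  -- the real form of `α, β, γ`
  have cr₀ : (Module.finrank ℂ T₀ : ℝ) = r₀ := by rw [hr₀]
  have cr₁ : (Module.finrank ℂ T₁ : ℝ) = r₁ := by rw [hr₁]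
  have eα : ((X.d₁ : ℝ) * ((((X.d₀ : ℝ) - Module.finrank ℂ T₀) + ((X.d₁ : ℝ) - Module.finrank ℂ T₁)) -
            ((X.ell₀ : ℝ) - w)) -
        (((X.d₀ : ℝ) + X.d₁) - 2 * X.nn) * (((X.d₁ : ℝ) - Module.finrank ℂ T₁) + ((X.ell₁ : ℝ) - y))) = (α : ℝ) := by
    rw [hα, hd₀', hd₁', hℓ₀', hlam']; push_cast; ring
  have eβ : ((X.d₁ : ℝ) * (((X.ell₀ : ℝ) - w) - ((X.d₀ : ℝ) - Module.finrank ℂ T₀)) -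
        ((X.nn : ℝ) - X.d₀) * (((X.d₁ : ℝ) - Module.finrank ℂ T₁) + ((X.ell₁ : ℝ) - y))) = (β : ℝ) := by
    rw [hβ, hd₀', hd₁', hℓ₀', hlam']; push_cast; ring
  have eγ : (X.d₁ : ℝ) * ((X.ellA : ℝ) - ya) = (γ : ℝ) := by
    rw [hγ, hlamA']; push_cast; ring
  have h53' : 0 ≤ (α : ℝ) + ε₁ * β - ε₂ * (β + γ) + ε₃ * δ := by
    have := h53
    rw [eα, eβ, eγ] at this
    exact this
  obtain ⟨hαpos, hαβ, hαβγ⟩ := endgame_trichotomy hβB' hγ0 hγB hδ h3 h32 h21 h1 h53'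
  -- `ε ≤ 1/(2M+1)`
  have hlamR : ((X.ell₁ : ℝ) - X.kap) = (lam : ℝ) := by
    rw [hlam, Nat.cast_sub hkap]
  have hMR : 2 * ((X.d₀ : ℝ) + X.d₁) * (((X.d₀ : ℝ) + X.d₁) + ((X.ell₁ : ℝ) - X.kap)) + 1 = 2 * (M : ℝ) + 1 := by
    rw [hlamR, hM]; push_cast; ring
  rw [hMR] at hε
  have key := quadratic_nonneg_of_trichotomy hβB hγ0 hγM hαpos hαβ hαβγ hε0 hε
  -- conclude
  have e51 : (X.d₁ : ℝ) * (((((X.d₀ : ℝ) - Module.finrank ℂ T₀) + ((X.d₁ : ℝ) - Module.finrank ℂ T₁)) -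
              ((X.ell₀ : ℝ) - w)) + ε * (((X.ell₀ : ℝ) - w) - ((X.d₀ : ℝ) - Module.finrank ℂ T₀)) -
            ε ^ 2 * ((X.ellA : ℝ) - ya)) -
        ((((X.d₀ : ℝ) + X.d₁) - 2 * X.nn) + ε * ((X.nn : ℝ) - X.d₀)) *
            (((X.d₁ : ℝ) - Module.finrank ℂ T₁) + ((X.ell₁ : ℝ) - y)) =
      (α : ℝ) + β * ε - γ * ε ^ 2 := by
    rw [hα, hβ, hγ, hd₀', hd₁', hℓ₀', hlam', hlamA']; push_cast; ring
  linarith [key, e51]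

end RoyWaldschmidt1997

end Literature.NumberTheory.Transcendental
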